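import Summits.CriticalPhenomena.SAWScalingLimit.Theorems.SAWDefectDecoherenceBoundaryClosureRPolygonLocalLimit
import Summits.CriticalPhenomena.SAWScalingLimit.Theorems.SAWDefectDecoherenceBoundaryClosureRPolygonLocalNoSingular
import Summits.CriticalPhenomena.SAWScalingLimit.Theorems.SAWDefectDecoherenceBoundaryClosureRPolygonLocalGreen
import Literature.Analysis.Complex.DbarAlongCalculus
import HarnessLib

/-!
# The local continuum identity `∫_P g ∂̄φ = -√3 n_k κ ∫ φ dμ` on a flat boundary ball, given the phases
(crux `BoundaryClosureR`, stmt-CriticalPhenomena-14004, line `polygon-parity-squeeze`, sub-goal of the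
registered stub `polygonLocalIdentity`, step (c); registered helper `localIdentity_of_phases`)

From the limit data `(g, μ, η)` of an admissible pinned polygon family along `ns → 0⁺` and a flat
boundary ball `B(z, s)` of form `k` off the root whose boundary darts carry phases `P_n → κ₀` (along a
filter `l ≤ atTop`), for every smooth `φ` supported in `B(z, s/2)`:

  `∫_P g ∂̄φ dA = -√3 · n_k · κ₀ · ∫ φ dμ`.

Proof.  `η(∂̄φ) = -√3 n_k κ₀ ∫ φ dμ` (`eta_dbar_eq_of_phases`).  The would-be singular part
`S ψ = η ψ - ∫_P ψ g dA` is additive and homogeneous (the bulk functionals are linear), sup-norm bounded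
(`P_bd` and `g ∈ L¹`), vanishes on tests supported inside `P` (`P_in`) and on tests supported in the
open exterior side (no scaled mid-edge enters the support), and kills the expanded level tests: for
`φ = ℓχ`, `∫ ℓχ dμ = 0` (`μ` lives on `∂P`, where `ℓ = 0`) and `∫_P g ∂̄(ℓχ) = 0`
(`setIntegral_mul_dbarAlong_levelMul_eq_zero`).  Hence `S` kills every smooth test in the ball
(`noSingularPart_of_levelTest`), in particular `∂̄φ`.  References: Duminil-Copin–Smirnov 2012 §3;
folklore distribution theory.  No definition is introduced.
-/

noncomputable section

open scoped BigOperators Topology ComplexConjugate ContDiff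
open Filter Set Metric Complex MeasureTheory
open Literature.Probability.LatticeModels Literature.Probability.RandomPlanarGeometry
open Literature.Probability.RandomPlanarGeometry.SAW
open Literature.Analysis.Complex (dbarAlong continuous_dbarAlong_one tsupport_dbarAlong_one_subset
  hasCompactSupport_dbarAlong_one contDiff_infty_dbarAlong dbarAlong_eq_zero_of_notMem_tsupport)
open Summit.CriticalPhenomena.SAWScalingLimit.Theses.SAWDefectDecoherence
open Summit.CriticalPhenomena.SAWScalingLimit.Theorems.PickHalfPlane

namespace Summit.CriticalPhenomena.SAWScalingLimit.Theorems.PolygonParitySqueeze.PolygonLocal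

/-! ### 1. Linearity of the normalised bulk functionals -/

/-- `N_δ(ψ₁ + ψ₂) = N_δ(ψ₁) + N_δ(ψ₂)`. [folklore] -/
theorem NF_add (Λ : ℝ → Finset HexVertex) (e b : ℝ → Sym2 HexVertex) (δ : ℝ) (ψ₁ ψ₂ : ℂ → ℂ) :
    NF Λ e b δ (ψ₁ + ψ₂) = NF Λ e b δ ψ₁ + NF Λ e b δ ψ₂ := by
  simp only [NF, Pi.add_apply, add_mul]
  rw [finsum_mem_add_distrib (MassRatio.Negative.hexDomainMidEdges_finite (Λ δ)), mul_add, add_div]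

/-- `N_δ(c ψ) = c N_δ(ψ)`. [folklore] -/
theorem NF_smul (Λ : ℝ → Finset HexVertex) (e b : ℝ → Sym2 HexVertex) (δ : ℝ) (c : ℂ) (ψ : ℂ → ℂ) :
    NF Λ e b δ (c • ψ) = c * NF Λ e b δ ψ := by
  simp only [NF, Pi.smul_apply, smul_eq_mul, mul_assoc]
  rw [← mul_finsum_mem]
  ring

/-- **No lattice on the exterior side of a flat ball.**  If the centres of `Λ_δ` lie in `D`, `D ∩ B(z,s)`
is the half-plane `{ℓ > 0}` and `ψ` is supported in `{ℓ < 0} ∩ B(z, s/2)`, then `N_δ(ψ) = 0` once `δ`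
is smaller than the gap between the support and the line. [folklore] -/
theorem NF_eq_zero_of_exterior {D : DobrushinDomain} {Λ : ℝ → Finset HexVertex} {e b : ℝ → Sym2 HexVertex}
    {δ : ℝ} (hδ : 0 < δ) (hcen : ∀ v ∈ Λ δ, (δ : ℂ) * hexCenter v ∈ D.carrier) {z : ℂ} {k : Fin 6} {s : ℝ}
    (hset : D.carrier ∩ ball z s = halfPlane k z ∩ ball z s) {ψ : ℂ → ℂ} {d : ℝ} (hδd : δ < d) (hds : d ≤ s / 2)
    (hgap : ∀ p ∈ tsupport ψ, ((p - z) * conj (innerNormal k)).re ≤ -d)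
    (hψs : tsupport ψ ⊆ ball z (s / 2)) : NF Λ e b δ ψ = 0 := by
  have hzero : ∀ x ∈ hexDomainMidEdges (Λ δ),
      ψ ((δ : ℂ) * hexMidpoint x) * hexParafermionicObservable (Λ δ) (e δ) hexCriticalFugacity (5 / 8) x = 0 := by
    intro x hx
    by_cases hψx : (δ : ℂ) * hexMidpoint x ∈ tsupport ψ
    · exfalso
      obtain ⟨hxe, v, hv, hvΛ⟩ := hx
      -- `x = {v, t}` with `v ∈ Λ δ`
      obtain ⟨t, hxt⟩ : ∃ t, x = s(v, t) := by
        induction x using Sym2.ind with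
        | h p q =>
          rcases Sym2.mem_iff.1 hv with rfl | rfl
          · exact ⟨q, rfl⟩
          · exact ⟨p, Sym2.eq_swap⟩
      subst hxt
      have hvt : hexGraph.Adj v t := (SimpleGraph.mem_edgeSet _).1 hxe
      have hdist : dist ((δ : ℂ) * hexCenter v) ((δ : ℂ) * hexMidpoint s(v, t)) ≤ δ := by
        rw [dist_eq_norm, ← mul_sub, norm_mul, Complex.norm_real, Real.norm_of_nonneg hδ.le]
        have := DecoherenceSynthesis.norm_hexMidpoint_sub_hexCenter_le hvt
        rw [norm_sub_rev] at this
        nlinarith [norm_nonneg (hexCenter v - hexMidpoint s(v, t))]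
      have h1 := hgap _ hψx
      have h2 := abs_level_le_dist k ((δ : ℂ) * hexMidpoint s(v, t)) ((δ : ℂ) * hexCenter v)
      have hsplit : (((δ : ℂ) * hexCenter v - z) * conj (innerNormal k)).re =
          (((δ : ℂ) * hexCenter v - (δ : ℂ) * hexMidpoint s(v, t)) * conj (innerNormal k)).re +
            (((δ : ℂ) * hexMidpoint s(v, t) - z) * conj (innerNormal k)).re := by
        rw [← Complex.add_re, ← add_mul, sub_add_sub_cancel]
      have hlev : (((δ : ℂ) * hexCenter v - z) * conj (innerNormal k)).re < 0 := by
        rw [hsplit]; have := (abs_le.1 h2).2; linarith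
      have hvb : (δ : ℂ) * hexCenter v ∈ ball z s := by
        have := mem_ball.1 (hψs hψx)
        rw [mem_ball]
        have := dist_triangle ((δ : ℂ) * hexCenter v) ((δ : ℂ) * hexMidpoint s(v, t)) z
        linarith
      have hD : (δ : ℂ) * hexCenter v ∈ D.carrier ∩ ball z s := ⟨hcen v hvΛ, hvb⟩
      rw [hset] at hD
      exact absurd ((mem_halfPlane_iff_level k z _).1 hD.1) (not_lt.2 hlev.le)
    · rw [image_eq_zero_of_notMem_tsupport hψx, zero_mul]
  rw [NF, finsum_mem_of_eqOn_zero hzero, mul_zero, zero_div]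

/-! ### 2. The local identity given the phases -/

/-- On a flat ball, the level vanishes on the frontier: `w ∈ ∂P ∩ B(z, s) ⟹ ℓ(w) = 0`. [folklore] -/
theorem level_eq_zero_of_mem_frontier {P : Set ℂ} (hP : IsOpen P) {z : ℂ} {k : Fin 6} {s : ℝ}
    (hset : P ∩ ball z s = halfPlane k z ∩ ball z s) {w : ℂ} (hw : w ∈ frontier P) (hws : w ∈ ball z s) :
    ((w - z) * conj (innerNormal k)).re = 0 := by
  rw [frontier, Set.mem_sdiff, hP.interior_eq] at hw
  obtain ⟨hwc, hwP⟩ := hw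
  have h1 : w ∈ closure (halfPlane k z ∩ ball z s) := by
    rw [← hset, inter_comm]; exact isOpen_ball.inter_closure ⟨hws, hwc⟩
  have h2 : closure (halfPlane k z ∩ ball z s) ⊆ {w : ℂ | 0 ≤ ((w - z) * conj (innerNormal k)).re} :=
    closure_minimal (fun y hy => le_of_lt ((mem_halfPlane_iff_level k z y).1 hy.1))
      (isClosed_le continuous_const (Complex.continuous_re.comp
        ((continuous_id.sub continuous_const).mul continuous_const)))
  have h3 : ¬ 0 < ((w - z) * conj (innerNormal k)).re := fun h => by
    have : w ∈ halfPlane k z ∩ ball z s := ⟨(mem_halfPlane_iff_level k z w).2 h, hws⟩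
    rw [← hset] at this
    exact hwP this.1
  have := h2 h1
  simp only [mem_setOf_eq] at this
  push Not at h3
  linarith

/-- **The local continuum identity given the phases** (registered helper of `polygonLocalIdentity`):
see the module docstring. [cite: DuminilCopinSmirnov2012, §3 (Lemma 1, summation by parts)] -/
theorem localIdentity_of_phases : ∀ (D : DobrushinDomain) (ρ : ℝ) (Λ : ℝ → Finset HexVertex) (m : ℝ → ℤ) (b : ℝ → Sym2 HexVertex), AdmissibleFamily D ρ Λ m b → ∀ (a : ℝ → Sym2 HexVertex) (r₀ : ℝ) (m₀ : ℝ → ℤ), PinnedFlatRoot D Λ b (D.pt 0) a r₀ m₀ → (∀ z ∈ frontier D.carrier, z ≠ D.pt 0 → BoundaryLayerBudgetAt Λ a b z) → DefectDecoherence → MassRatio → ∀ (ns : ℕ → ℝ) (g : ℂ → ℂ) (μ : MeasureTheory.Measure ℂ) (η : (ℂ → ℂ) → ℂ) (l : Filter ℕ), Filter.Tendsto ns Filter.atTop (𝓝[>] 0) → l ≤ Filter.atTop → l.NeBot → DifferentiableOn ℂ g D.carrier → (∀ ψ : ℂ → ℂ, Continuous ψ → HasCompactSupport ψ → D.pt 0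 ∉ tsupport ψ → Filter.Tendsto (fun n => NF Λ a b (ns n) ψ) Filter.atTop (𝓝 (η ψ))) → (∀ ψ : ℂ → ℂ, Continuous ψ → HasCompactSupport ψ → tsupport ψ ⊆ D.carrier → η ψ = ∫ z, ψ z * g z) → (∀ K : Set ℂ, IsCompact K → D.pt 0 ∉ K → ∃ C : ℝ, ∀ ψ : ℂ → ℂ, Continuous ψ → tsupport ψ ⊆ K → ∀ M : ℝ, (∀ z, ‖ψ z‖ ≤ M) → ‖η ψ‖ ≤ C * M) → (∀ K : Set ℂ, IsCompact K → D.pt 0 ∉ K → MeasureTheory.IntegrableOn g (K ∩ D.carrier)) → (∀ K : Set ℂ, IsCompact K → D.pt 0 ∉ K → μ K < ⊤) → μ (frontier D.carrier)ᶜ = 0 → (∀ w : ℂ → ℝ, Continuous w → HasCompactSupport w → D.pt 0 ∉ tsupport w → Filter.Tendsto (fun n => (ns n) * ∑ᶠ e ∈ hexDomainBoundary (Λ (ns n)), w (((ns n : ℝ) : ℂ) * hexMidpoint e) * (‖hexParafermionicObservable (Λ (ns n)) (a (ns n)) hexCriticalFugacity 0 e‖ / ‖hexParafermionicObservable (Λ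 (ns n)) (a (ns n)) hexCriticalFugacity 0 (b (ns n))‖)) Filter.atTop (𝓝 (∫ z, w z ∂μ))) → ∀ (z : ℂ) (k : Fin 6) (s : ℝ), 0 < s → D.carrier ∩ Metric.ball z s = halfPlane k z ∩ Metric.ball z s → (∀ᶠ δ : ℝ in 𝓝[>] 0, ∃ nthr : ℤ, ∀ v : HexVertex, (δ : ℂ) * hexCenter v ∈ Metric.ball z s → (v ∈ Λ δ ↔ nthr ≤ zigzagForm k v)) → D.pt 0 ∉ Metric.closedBall z s → ∀ (P : ℕ → ℂ) (κ₀ : ℂ), Filter.Tendsto P l (𝓝 κ₀) → (∀ᶠ n : ℕ in Filter.atTop, ∀ v t : HexVertex, v ∈ Λ (ns n) → t ∉ Λ (ns n) → hexGraph.Adj v t → ((ns n : ℝ) : ℂ) * hexCenter v ∈ Metric.ball z (3 * s / 4) → hexParafermionicObservable (Λ (ns n)) (a (ns n)) hexCriticalFugacity (5 / 8) s(v, t) * ((‖hexParafermionicObservable (Λ (ns n)) (a (ns n)) hexCriticalFugacity 0 (b (ns n))‖ : ℝ) : ℂ) = P n * ((‖hexParafermionicObservable (Λ (ns n)) (a (ns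 n)) hexCriticalFugacity 0 s(v, t)‖ : ℝ) : ℂ) * hexParafermionicObservable (Λ (ns n)) (a (ns n)) hexCriticalFugacity (5 / 8) (b (ns n))) → ∀ φ : ℂ → ℂ, ContDiff ℝ ∞ φ → HasCompactSupport φ → tsupport φ ⊆ Metric.ball z (s / 2) → ∫ w in D.carrier, g w * Literature.Analysis.Complex.dbarAlong 1 φ w = -(Real.sqrt 3 : ℂ) * innerNormal k * κ₀ * ∫ w, φ w ∂μ := by
  intro D ρ Λ m b hAF a r₀ m₀ hPR hBL hDD hMR ns g μ η l hns hl hlne hg hbulk hin hbd hL1 hmf hms hside z k s hs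
    hset hex hroot P κ₀ hP hphase φ hφ hφc hφs
  haveI := hlne
  ---------------------------------------------------------------- (†) on the ball
  have dagger : ∀ φ' : ℂ → ℂ, ContDiff ℝ ∞ φ' → HasCompactSupport φ' → tsupport φ' ⊆ ball z (s / 2) →
      η (dbarAlong 1 φ') = -(Real.sqrt 3 : ℂ) * innerNormal k * κ₀ * ∫ w, φ' w ∂μ :=
    fun φ' h1 h2 h3 => eta_dbar_eq_of_phases D ρ Λ m b hAF a r₀ m₀ hPR hBL hDD hMR ns μ η l hns hl hlne hbulk hmf
      hside z k s hs hex hroot P κ₀ hP hphase φ' h1 h2 h3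
  ---------------------------------------------------------------- the class of tests on the ball
  set Kc : Set ℂ := closedBall z (s / 2) with hKc
  have hKcc : IsCompact Kc := isCompact_closedBall _ _
  have hKc0 : D.pt 0 ∉ Kc := fun h => hroot (closedBall_subset_closedBall (by linarith) h)
  have hgi : IntegrableOn g (Kc ∩ D.carrier) := hL1 Kc hKcc hKc0
  have hDm : MeasurableSet D.carrier := D.isOpen.measurableSet
  have hcls : ∀ ψ : ℂ → ℂ, Continuous ψ → tsupport ψ ⊆ ball z (s / 2) →
      HasCompactSupport ψ ∧ D.pt 0 ∉ tsupport ψ ∧ IntegrableOn (fun w => ψ w * g w) D.carrier ∧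
      ∀ M : ℝ, (∀ w, ‖ψ w‖ ≤ M) → ‖∫ w in D.carrier, ψ w * g w‖ ≤ M * ∫ w in Kc ∩ D.carrier, ‖g w‖ := by
    intro ψ hψ hψs
    have hψK : tsupport ψ ⊆ Kc := hψs.trans ball_subset_closedBall
    have hψc : HasCompactSupport ψ := IsCompact.of_isClosed_subset hKcc (isClosed_tsupport ψ) hψK
    have hψ0 : D.pt 0 ∉ tsupport ψ := fun h => hKc0 (hψK h)
    obtain ⟨M₀, hM₀⟩ := hψ.norm.bddAbove_range_of_hasCompactSupport hψc.norm
    have hiK : IntegrableOn (fun w => ψ w * g w) (Kc ∩ D.carrier) :=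
      hgi.bdd_mul hψ.aestronglyMeasurable (Eventually.of_forall fun w => hM₀ ⟨w, rfl⟩)
    have hzero : ∀ w ∈ D.carrier \ (Kc ∩ D.carrier), ψ w * g w = 0 := fun w hw => by
      have hwK : w ∉ Kc := fun h => hw.2 ⟨h, hw.1⟩
      rw [image_eq_zero_of_notMem_tsupport (fun h => hwK (hψK h)), zero_mul]
    have hiD : IntegrableOn (fun w => ψ w * g w) D.carrier := hiK.of_forall_sdiff_eq_zero hDm hzero
    refine ⟨hψc, hψ0, hiD, fun M hM => ?_⟩
    rw [setIntegral_eq_of_subset_of_forall_sdiff_eq_zero hDm inter_subset_right hzero]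
    calc ‖∫ w in Kc ∩ D.carrier, ψ w * g w‖ ≤ ∫ w in Kc ∩ D.carrier, M * ‖g w‖ :=
          norm_integral_le_of_norm_le (hgi.norm.const_mul M) (Eventually.of_forall fun w => by
            rw [norm_mul]; exact mul_le_mul_of_nonneg_right (hM w) (norm_nonneg _))
      _ = M * ∫ w in Kc ∩ D.carrier, ‖g w‖ := integral_const_mul _ _
  ---------------------------------------------------------------- the would-be singular part `S`
  set S : (ℂ → ℂ) → ℂ := fun ψ => η ψ - ∫ w in D.carrier, ψ w * g w with hSdef
  -- additivity
  have hadd : ∀ ψ₁ ψ₂ : ℂ → ℂ, Continuous ψ₁ → tsupport ψ₁ ⊆ ball z (s / 2) → Continuous ψ₂ →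
      tsupport ψ₂ ⊆ ball z (s / 2) → S (ψ₁ + ψ₂) = S ψ₁ + S ψ₂ := by
    intro ψ₁ ψ₂ hψ₁ hψ₁s hψ₂ hψ₂s
    obtain ⟨hc1, h01, hi1, -⟩ := hcls ψ₁ hψ₁ hψ₁s
    obtain ⟨hc2, h02, hi2, -⟩ := hcls ψ₂ hψ₂ hψ₂s
    have hη : η (ψ₁ + ψ₂) = η ψ₁ + η ψ₂ := by
      have h120 : D.pt 0 ∉ tsupport (ψ₁ + ψ₂) := fun h =>
        (tsupport_add ψ₁ ψ₂ h).elim h01 h02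
      refine tendsto_nhds_unique (hbulk _ (hψ₁.add hψ₂) (hc1.add hc2) h120)
        (((hbulk _ hψ₁ hc1 h01).add (hbulk _ hψ₂ hc2 h02)).congr fun n => (NF_add Λ a b (ns n) ψ₁ ψ₂).symm)
    have hI : ∫ w in D.carrier, (ψ₁ + ψ₂) w * g w =
        (∫ w in D.carrier, ψ₁ w * g w) + ∫ w in D.carrier, ψ₂ w * g w := by
      simp only [Pi.add_apply, add_mul]
      exact integral_add hi1 hi2
    simp only [hSdef]
    rw [hη, hI]; ring
  -- homogeneity
  have hsmul : ∀ ψ : ℂ → ℂ, Continuous ψ → tsupport ψ ⊆ ball z (s / 2) → ∀ c : ℂ, S (c • ψ) = c * S ψ := by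
    intro ψ hψ hψs c
    obtain ⟨hc1, h01, hi1, -⟩ := hcls ψ hψ hψs
    have hη : η (c • ψ) = c * η ψ := by
      have hc0 : D.pt 0 ∉ tsupport (c • ψ) := fun h => h01 (tsupport_smul_subset_right (fun _ => c) ψ h)
      refine tendsto_nhds_unique (hbulk _ (hψ.const_smul c) (hc1.smul_left) hc0)
        (((hbulk _ hψ hc1 h01).const_mul c).congr fun n => (NF_smul Λ a b (ns n) c ψ).symm)
    have hI : ∫ w in D.carrier, (c • ψ) w * g w = c * ∫ w in D.carrier, ψ w * g w := by
      simp only [Pi.smul_apply, smul_eq_mul, mul_assoc]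
      exact integral_const_mul _ _
    simp only [hSdef]
    rw [hη, hI]; ring
  -- sup-norm bound
  have hbdS : ∃ C : ℝ, ∀ ψ : ℂ → ℂ, Continuous ψ → tsupport ψ ⊆ ball z (s / 2) → ∀ M : ℝ,
      (∀ w, ‖ψ w‖ ≤ M) → ‖S ψ‖ ≤ C * M := by
    obtain ⟨C₁, hC₁⟩ := hbd Kc hKcc hKc0
    refine ⟨C₁ + ∫ w in Kc ∩ D.carrier, ‖g w‖, fun ψ hψ hψs M hM => ?_⟩
    obtain ⟨-, -, -, hI⟩ := hcls ψ hψ hψs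
    calc ‖S ψ‖ ≤ ‖η ψ‖ + ‖∫ w in D.carrier, ψ w * g w‖ := norm_sub_le _ _
      _ ≤ C₁ * M + M * ∫ w in Kc ∩ D.carrier, ‖g w‖ :=
          add_le_add (hC₁ ψ hψ (hψs.trans ball_subset_closedBall) M hM) (hI M hM)
      _ = (C₁ + ∫ w in Kc ∩ D.carrier, ‖g w‖) * M := by ring
  -- vanishing on the interior side
  have hinS : ∀ ψ : ℂ → ℂ, Continuous ψ → tsupport ψ ⊆ ball z (s / 2) →
      tsupport ψ ⊆ {w : ℂ | 0 < ((w - z) * (starRingEnd ℂ) (innerNormal k)).re} → S ψ = 0 := by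
    intro ψ hψ hψs hψp
    obtain ⟨hc1, -, -, -⟩ := hcls ψ hψ hψs
    have hψD : tsupport ψ ⊆ D.carrier := fun w hw => by
      have : w ∈ halfPlane k z ∩ ball z s := ⟨hψp hw, ball_subset_ball (by linarith) (hψs hw)⟩
      rw [← hset] at this
      exact this.1
    have h1 := hin ψ hψ hc1 hψD
    have h2 : ∫ w in D.carrier, ψ w * g w = ∫ w, ψ w * g w :=
      setIntegral_eq_integral_of_forall_compl_eq_zero fun w hw => by
        rw [image_eq_zero_of_notMem_tsupport (fun h => hw (hψD h)), zero_mul]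
    simp only [hSdef]
    rw [h1, h2, sub_self]
  -- vanishing on the exterior side
  have houtS : ∀ ψ : ℂ → ℂ, Continuous ψ → tsupport ψ ⊆ ball z (s / 2) →
      tsupport ψ ⊆ {w : ℂ | ((w - z) * (starRingEnd ℂ) (innerNormal k)).re < 0} → S ψ = 0 := by
    intro ψ hψ hψs hψn
    obtain ⟨hc1, h01, -, -⟩ := hcls ψ hψ hψs
    -- the integral vanishes: `ψ = 0` on `D`
    have hI : ∫ w in D.carrier, ψ w * g w = 0 := by
      refine setIntegral_eq_zero_of_forall_eq_zero fun w hw => ?_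
      by_cases hψw : w ∈ tsupport ψ
      · exfalso
        have : w ∈ D.carrier ∩ ball z s := ⟨hw, ball_subset_ball (by linarith) (hψs hψw)⟩
        rw [hset] at this
        have h1 := (mem_halfPlane_iff_level k z w).1 this.1
        have h2 : ((w - z) * conj (innerNormal k)).re < 0 := hψn hψw
        linarith
      · rw [image_eq_zero_of_notMem_tsupport hψw, zero_mul]
    -- `η ψ = 0`: the bulk functionals vanish eventually
    have hη : η ψ = 0 := by
      by_cases hne : (tsupport ψ).Nonempty
      · have hcont : Continuous fun w : ℂ => ((w - z) * conj (innerNormal k)).re :=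
          Complex.continuous_re.comp ((continuous_id.sub continuous_const).mul continuous_const)
        obtain ⟨p₀, hp₀, hmax⟩ := hc1.isCompact.exists_isMaxOn hne hcont.continuousOn
        set d : ℝ := min (-((p₀ - z) * conj (innerNormal k)).re) (s / 2) with hd
        have hd0 : 0 < d := lt_min (by have := hψn hp₀; simp only [mem_setOf_eq] at this; linarith) (by linarith)
        have hgap : ∀ p ∈ tsupport ψ, ((p - z) * conj (innerNormal k)).re ≤ -d := fun p hp => by
          have h1 := hmax hp
          simp only [mem_setOf_eq] at h1
          have : d ≤ -((p₀ - z) * conj (innerNormal k)).re := min_le_left _ _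
          linarith
        have hcen := (hns.eventually hAF.2.2.1)
        have hsmall : ∀ᶠ n in atTop, ns n < d := hns.eventually (nhdsWithin_le_nhds (eventually_lt_nhds hd0))
        have hpos := hns.eventually (self_mem_nhdsWithin : Ioi (0 : ℝ) ∈ 𝓝[>] (0 : ℝ))
        have hev : ∀ᶠ n in atTop, NF Λ a b (ns n) ψ = 0 := by
          filter_upwards [hcen, hsmall, hpos] with n hn hnd hn0
          exact NF_eq_zero_of_exterior hn0 hn.2.2.2.1 hset hnd (min_le_right _ _) hgap hψs
        exact tendsto_nhds_unique (hbulk ψ hψ hc1 h01) (tendsto_const_nhds.congr' (hev.mono fun n hn => hn.symm))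
      · rw [not_nonempty_iff_eq_empty] at hne
        have hψ0 : ψ = 0 := by
          funext w; exact image_eq_zero_of_notMem_tsupport (by rw [hne]; exact notMem_empty w)
        have hc0 : D.pt 0 ∉ tsupport (0 : ℂ → ℂ) := by rw [← hψ0, hne]; exact notMem_empty _
        have T := hbulk ψ hψ hc1 h01
        have hNF0 : ∀ n, NF Λ a b (ns n) ψ = 0 := fun n => by
          rw [hψ0]; simp [NF]
        exact tendsto_nhds_unique T (tendsto_const_nhds.congr fun n => (hNF0 n).symm)
    simp only [hSdef]
    rw [hη, hI, sub_self]
  -- the expanded level tests are killed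
  have htest : ∀ χ : ℂ → ℂ, ContDiff ℝ ∞ χ → HasCompactSupport χ → tsupport χ ⊆ ball z (s / 2) →
      Continuous (dbarAlong 1 χ) ∧ tsupport (dbarAlong 1 χ) ⊆ tsupport χ ∧
      S (fun w => innerNormal k / 2 * χ w +
        ((((w - z) * (starRingEnd ℂ) (innerNormal k)).re : ℝ) : ℂ) * dbarAlong 1 χ w) = 0 := by
    intro χ hχ hχc hχs
    have hχ1 : ContDiff ℝ 1 χ := hχ.of_le (by
      change ((1 : ℕ∞) : WithTop ℕ∞) ≤ ((⊤ : ℕ∞) : WithTop ℕ∞); exact WithTop.coe_le_coe.2 le_top)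
    refine ⟨continuous_dbarAlong_one hχ1, tsupport_dbarAlong_one_subset χ, ?_⟩
    -- the level test `ℓχ`
    set Φ : ℂ → ℂ := fun w => ((((w - z) * conj (innerNormal k)).re : ℝ) : ℂ) * χ w with hΦ
    have hΦs : ContDiff ℝ ∞ Φ := (contDiff_level z (innerNormal k)).mul hχ
    have hΦsupp : tsupport Φ ⊆ tsupport χ :=
      tsupport_mul_subset_right (f := fun w => ((((w - z) * conj (innerNormal k)).re : ℝ) : ℂ)) (g := χ)
    have hΦc : HasCompactSupport Φ := hχc.mono' ((subset_tsupport _).trans hΦsupp)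
    have hexp : (fun w => innerNormal k / 2 * χ w +
        ((((w - z) * (starRingEnd ℂ) (innerNormal k)).re : ℝ) : ℂ) * dbarAlong 1 χ w) = dbarAlong 1 Φ := by
      funext w
      exact (dbarAlong_one_levelMul z (innerNormal k) (hχ1.differentiable one_ne_zero w)).symm
    rw [hexp]
    -- `η(∂̄(ℓχ)) = -√3 n κ₀ ∫ ℓχ dμ = 0`
    have h1 := dagger Φ hΦs hΦc (hΦsupp.trans hχs)
    have hμ0 : ∫ w, Φ w ∂μ = 0 := by
      refine integral_eq_zero_of_ae ?_
      have hsub : {w | Φ w ≠ (0 : ℂ → ℂ) w} ⊆ (frontier D.carrier)ᶜ := by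
        intro w hw hwf
        apply hw
        simp only [Pi.zero_apply, hΦ]
        by_cases hwχ : w ∈ tsupport χ
        · rw [level_eq_zero_of_mem_frontier D.isOpen hset hwf (ball_subset_ball (by linarith) (hχs hwχ))]
          simp
        · rw [image_eq_zero_of_notMem_tsupport hwχ, mul_zero]
      exact measure_mono_null hsub hms
    rw [hμ0, mul_zero] at h1
    -- `∫_P g ∂̄(ℓχ) = 0`
    have h2 := setIntegral_mul_dbarAlong_levelMul_eq_zero D.carrier z (innerNormal k) s g χ D.isOpen
      (norm_innerNormal k) hs hset hg hgi hχ hχs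
    have h2' : ∫ w in D.carrier, dbarAlong 1 Φ w * g w = 0 := by
      rw [← h2]; exact integral_congr_ae (Eventually.of_forall fun w => mul_comm _ _)
    simp only [hSdef]
    rw [h1, h2', sub_self]
  ---------------------------------------------------------------- no singular part, applied to `∂̄φ`
  have hn0 : innerNormal k ≠ 0 := fun h => by
    have := norm_innerNormal k; rw [h, norm_zero] at this; exact zero_ne_one this
  have key := noSingularPart_of_levelTest z (innerNormal k) (s / 2) S (dbarAlong 1) hn0 hadd hsmul hbdS hinS houtS
    htest (dbarAlong 1 φ) (contDiff_infty_dbarAlong hφ 1) (hasCompactSupport_dbarAlong_one hφc)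
    ((tsupport_dbarAlong_one_subset φ).trans hφs)
  -- `key : η(∂̄φ) - ∫_P ∂̄φ g = 0`
  have h3 : ∫ w in D.carrier, g w * dbarAlong 1 φ w = ∫ w in D.carrier, dbarAlong 1 φ w * g w :=
    integral_congr_ae (Eventually.of_forall fun w => mul_comm _ _)
  rw [h3, ← dagger φ hφ hφc hφs]
  simp only [hSdef] at key
  exact (sub_eq_zero.1 key).symm

end Summit.CriticalPhenomena.SAWScalingLimit.Theorems.PolygonParitySqueeze.PolygonLocal

end
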